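import Literature.MathematicalPhysics.QuantumFieldTheory.SUNBakryEmeryCurvature
import HarnessLib

/-!
# Bakry–Émery curvature for conjugation-quadratic trace potentials on `SU(N)`

The one-link conditional laws of single-site (Eguchi–Kawai type) unitary matrix models are Gibbs
tilts of the Haar measure of `SU(N)` by potentials of the form
`S(Q) = c₀ + c Σ_k Re tr(Q A_k Qᴴ B_k)` with unitary `A_k, B_k` — QUADRATIC in the link (the link and
its inverse both occur in a reduced plaquette `tr V_ν† V_μ† V_ν V_μ`, Makeenko (14.38)), not the linear
"staple" tilt `c Re tr(Q B)` of lattice Yang–Mills with `L ≥ 2` (Shen–Zhu–Zhu Lemma 4.1).  This file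
supplies the curvature input of `SUNBakryEmery.poincare_of_curvature` for such potentials:

* `quadPot A B Q = Re tr(Q A Qᴴ B)`, its smoothness and its left-invariant derivatives
  `D_X Re tr(Q A Qᴴ B) = Re tr(Q (XA) Qᴴ B) + Re tr(Q (A Xᴴ) Qᴴ B)` (`matD_quadPot`);
* the frame Hessian form `Σ_{αβ} a_α a_β D_α D_β S = Re tr(Q (Z²A − 2 Z A Z + A Z²) Qᴴ B)`,
  `Z = Σ a_α Y_α` (`sum_sum_hess_quadPot`) and its bound by `4 ‖Z‖_F²` for unitary `Q, A, B`
  (`abs_sum_sum_hess_quadPot_le`) — the single-site analogue of Shen–Zhu–Zhu's Hessian bound Lemma 4.1;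
* the generic passage from a frame-Hessian bound `Hess_S ≤ h Γ` to the curvature–dimension inequality
  `(N/2 − h) Γ(u,u) ≤ Γ₂^S(u)` on `SU(N)` (`Gam2_ge_of_hess_le`, Ricci term `N/2` from
  `sum_sum_sq_comm_matD`), and the resulting curvature constant `N/2 − 4|c|·#k` for
  `S = c₀ + c Σ_k Re tr(Q A_k Qᴴ B_k)` (`Gam2_quadPotSum_ge`);
* the Poincaré inequality for these tilts (`poincare_quadPotSum`), by `poincare_of_curvature`.

Nothing here concerns the Yang–Mills mass gap.

## References

* H. Shen, R. Zhu, X. Zhu, CMP 400 (2023) 805–851, arXiv:2204.12737, §2 (2.4), Lemma 4.1, (4.7)–(4.8).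
* D. Bakry, I. Gentil, M. Ledoux, *Analysis and Geometry of Markov Diffusion Operators* (2014), Prop. 4.8.1.
* Y. Makeenko, *Methods of Contemporary Gauge Theory*, §14.3 (14.38)–(14.40).
-/

noncomputable section

open scoped Matrix ComplexConjugate BigOperators

namespace Literature.MathematicalPhysics.QuantumFieldTheory

namespace SUNBakryEmery

open scoped Matrix.Norms.Frobenius ContDiff Topology
open Matrix Complex Finset MeasureTheory

variable {N : ℕ}

/-! ### The quadratic potential and its derivatives -/

/-- The **conjugation-quadratic trace potential** `Q ↦ Re tr(Q A Qᴴ B)` (one reduced plaquette of a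
single-site model seen from one link, Makeenko (14.38)). [cite: Makeenko2023, §14.3 (14.38) (PDF p. 244)] -/
def quadPot (A B : Matrix (Fin N) (Fin N) ℂ) : Matrix (Fin N) (Fin N) ℂ → ℝ :=
  fun Q => (Q * A * Qᴴ * B).trace.re

/-- Unfolding `quadPot`. [folklore] -/
private theorem quadPot_apply (A B Q : Matrix (Fin N) (Fin N) ℂ) :
    quadPot A B Q = (Q * A * Qᴴ * B).trace.re := rfl

section Calculus

attribute [local instance 2000] matTop

/-- `Q ↦ Qᴴ` as a real continuous linear map (plumbing). [folklore] -/
private def cTrL : Matrix (Fin N) (Fin N) ℂ →L[ℝ] Matrix (Fin N) (Fin N) ℂ :=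
  LinearMap.toContinuousLinearMap
    { toFun := fun Q => Qᴴ
      map_add' := fun P Q => Matrix.conjTranspose_add P Q
      map_smul' := fun c Q => by
        rw [RingHom.id_apply, Matrix.conjTranspose_smul, star_trivial] }

/-- Evaluation of `cTrL` (plumbing). [folklore] -/
@[simp] private theorem cTrL_apply (Q : Matrix (Fin N) (Fin N) ℂ) : cTrL Q = Qᴴ := rfl

/-- Derivative of `Q ↦ Q A Qᴴ`. [folklore] -/
private theorem hasFDerivAt_mul_mul_conjTranspose (A Q : Matrix (Fin N) (Fin N) ℂ) :
    HasFDerivAt (fun Q : Matrix (Fin N) (Fin N) ℂ => Q * A * Qᴴ)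
      ((Q * A) • (cTrL (N := N)) +
        (ContinuousLinearMap.mulLeftRight ℝ (Matrix (Fin N) (Fin N) ℂ) 1 A).smulRight Qᴴ) Q := by
  have h1 : HasFDerivAt (fun Q : Matrix (Fin N) (Fin N) ℂ => Q * A)
      (ContinuousLinearMap.mulLeftRight ℝ (Matrix (Fin N) (Fin N) ℂ) 1 A) Q := hasFDerivAt_mul_const A Q
  have h2 : HasFDerivAt (fun Q : Matrix (Fin N) (Fin N) ℂ => Qᴴ) (cTrL (N := N)) Q :=
    (cTrL (N := N)).hasFDerivAt
  exact h1.mul' h2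

/-- `Q ↦ Q A Qᴴ` is smooth. [folklore] -/
private theorem contDiff_mul_mul_conjTranspose (A : Matrix (Fin N) (Fin N) ℂ) :
    ContDiff ℝ ∞ (fun Q : Matrix (Fin N) (Fin N) ℂ => Q * A * Qᴴ) :=
  (contDiff_id.mul contDiff_const).mul (cTrL (N := N)).contDiff

/-- `Re tr(Q A Qᴴ B)` is smooth in `Q`. [cite: arXiv220412737, §2 (2.4) (p. 10)] -/
theorem contDiff_quadPot (A B : Matrix (Fin N) (Fin N) ℂ) : ContDiff ℝ ∞ (quadPot A B) := by
  have : quadPot A B = fun Q => reTrMul B (Q * A * Qᴴ) := by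
    funext Q; simp [quadPot]
  rw [this]
  exact (reTrMul B).contDiff.comp (contDiff_mul_mul_conjTranspose A)

/-- **Left-invariant derivative of the quadratic potential**:
`D_X Re tr(Q A Qᴴ B) = Re tr(Q (X A) Qᴴ B) + Re tr(Q (A Xᴴ) Qᴴ B)`. [cite: arXiv220412737, §2 (2.4) (p. 10)] -/
theorem matD_quadPot (X A B : Matrix (Fin N) (Fin N) ℂ) :
    matD X (quadPot A B) = fun Q => quadPot (X * A) B Q + quadPot (A * Xᴴ) B Q := by
  funext Q
  have hq : quadPot A B = fun Q => reTrMul B (Q * A * Qᴴ) := by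
    funext Q; simp [quadPot]
  have hd := ((reTrMul B).hasFDerivAt.comp Q (hasFDerivAt_mul_mul_conjTranspose A Q)).fderiv
  rw [matD_apply, hq]
  erw [hd]
  simp only [ContinuousLinearMap.coe_comp, Function.comp_apply, _root_.add_apply,
    _root_.smul_apply, cTrL_apply, ContinuousLinearMap.smulRight_apply,
    ContinuousLinearMap.mulLeftRight_apply, one_mul, smul_eq_mul, reTrMul_apply, quadPot,
    Matrix.conjTranspose_mul, Matrix.add_mul, trace_add, Complex.add_re]
  simp only [Matrix.mul_assoc]
  ring

/-- **Second left-invariant derivatives of the quadratic potential** for skew directions `Xᴴ = −X`,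
`Yᴴ = −Y`: `D_Y D_X Re tr(Q A Qᴴ B) = Re tr(Q(YXA − XAY − YAX + AXY)Qᴴ B)`. [cite: arXiv220412737, §2 (2.4) (p. 10)] -/
theorem matD_matD_quadPot {X Y : Matrix (Fin N) (Fin N) ℂ} (hX : Xᴴ = -X) (hY : Yᴴ = -Y)
    (A B Q : Matrix (Fin N) (Fin N) ℂ) :
    matD Y (matD X (quadPot A B)) Q =
      quadPot (Y * X * A) B Q - quadPot (X * A * Y) B Q - quadPot (Y * A * X) B Q + quadPot (A * X * Y) B Q := by
  rw [matD_quadPot X A B, hX, matD_fun_add (contDiff_quadPot _ _) (contDiff_quadPot _ _)]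
  simp only [matD_quadPot, hY, Matrix.mul_neg, Matrix.neg_mul, Matrix.mul_assoc]
  have hneg : ∀ M : Matrix (Fin N) (Fin N) ℂ, quadPot (-M) B Q = -quadPot M B Q := fun M => by
    simp [quadPot]
  simp only [hneg, neg_neg]
  ring

end Calculus

/-! ### The frame Hessian form of the quadratic potential -/

/-- Bilinear expansion: `Σ_{αβ} a_α a_β Re tr(P Y_α M Y_β R) = Re tr(P Z M Z R)`, `Z = Σ a_α Y_α`. [folklore] -/
private theorem sum_sum_mul_mul_re_trace₅ (a : FrameIdx N → ℝ) (P M R : Matrix (Fin N) (Fin N) ℂ) :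
    ∑ α, ∑ β, a α * a β * (P * frame α * M * frame β * R).trace.re =
      (P * (∑ α, a α • frame α) * M * (∑ α, a α • frame α) * R).trace.re := by
  simp only [Matrix.sum_mul, Matrix.mul_smul, Matrix.smul_mul, trace_sum, trace_smul,
    Complex.re_sum, Complex.smul_re, smul_eq_mul, Finset.mul_sum]
  rw [sum_comm]
  refine sum_congr rfl fun α _ => sum_congr rfl fun β _ => ?_
  ring

/-- **The frame Hessian form of the quadratic potential**: with `a_α = D_α u(Q)` and
`Z = Σ_α a_α Y_α` (`frameGrad (dirFun u Q)`),
`Σ_{αβ} a_α a_β D_α D_β Re tr(Q A Qᴴ B) = Re tr(QZZAQᴴB) − 2 Re tr(QZAZQᴴB) + Re tr(QAZZQᴴB)`.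
[cite: arXiv220412737, Lemma 4.1 (4.2)-(4.4)] -/
theorem sum_sum_hess_quadPot (A B : Matrix (Fin N) (Fin N) ℂ) (u : Matrix (Fin N) (Fin N) ℂ → ℝ)
    (Q : Matrix (Fin N) (Fin N) ℂ) :
    ∑ α, ∑ β, matD (frame α) u Q * matD (frame β) u Q * matD (frame α) (matD (frame β) (quadPot A B)) Q =
      (Q * frameGrad (dirFun u Q) * frameGrad (dirFun u Q) * (A * Qᴴ * B)).trace.re
        - 2 * (Q * frameGrad (dirFun u Q) * A * frameGrad (dirFun u Q) * (Qᴴ * B)).trace.re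
        + (Q * A * frameGrad (dirFun u Q) * frameGrad (dirFun u Q) * (Qᴴ * B)).trace.re := by
  set a : FrameIdx N → ℝ := fun α => matD (frame α) u Q with ha
  have hZ : frameGrad (dirFun u Q) = ∑ α, a α • frame α := rfl
  have hterm : ∀ α β, matD (frame α) (matD (frame β) (quadPot A B)) Q =
      (Q * frame α * 1 * frame β * (A * Qᴴ * B)).trace.re
        - (Q * frame β * A * frame α * (Qᴴ * B)).trace.re
        - (Q * frame α * A * frame β * (Qᴴ * B)).trace.re
        + (Q * A * frame β * 1 * frame α * (Qᴴ * B)).trace.re := by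
    intro α β
    rw [matD_matD_quadPot (frame_conjTranspose β) (frame_conjTranspose α)]
    simp only [quadPot, Matrix.mul_one, Matrix.mul_assoc]
  simp_rw [hterm]
  have e1 : ∑ α, ∑ β, a α * a β * (Q * frame α * 1 * frame β * (A * Qᴴ * B)).trace.re =
      (Q * frameGrad (dirFun u Q) * frameGrad (dirFun u Q) * (A * Qᴴ * B)).trace.re := by
    rw [sum_sum_mul_mul_re_trace₅ a Q 1 (A * Qᴴ * B), hZ, Matrix.mul_one]
  have e2 : ∑ α, ∑ β, a α * a β * (Q * frame β * A * frame α * (Qᴴ * B)).trace.re =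
      (Q * frameGrad (dirFun u Q) * A * frameGrad (dirFun u Q) * (Qᴴ * B)).trace.re := by
    rw [sum_comm]
    have : ∑ β, ∑ α, a α * a β * (Q * frame β * A * frame α * (Qᴴ * B)).trace.re =
        ∑ β, ∑ α, a β * a α * (Q * frame β * A * frame α * (Qᴴ * B)).trace.re :=
      sum_congr rfl fun β _ => sum_congr rfl fun α _ => by ring
    rw [this, sum_sum_mul_mul_re_trace₅ a Q A (Qᴴ * B), hZ]
  have e3 : ∑ α, ∑ β, a α * a β * (Q * frame α * A * frame β * (Qᴴ * B)).trace.re =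
      (Q * frameGrad (dirFun u Q) * A * frameGrad (dirFun u Q) * (Qᴴ * B)).trace.re := by
    rw [sum_sum_mul_mul_re_trace₅ a Q A (Qᴴ * B), hZ]
  have e4 : ∑ α, ∑ β, a α * a β * (Q * A * frame β * 1 * frame α * (Qᴴ * B)).trace.re =
      (Q * A * frameGrad (dirFun u Q) * frameGrad (dirFun u Q) * (Qᴴ * B)).trace.re := by
    rw [sum_comm]
    have : ∑ β, ∑ α, a α * a β * (Q * A * frame β * 1 * frame α * (Qᴴ * B)).trace.re =
        ∑ β, ∑ α, a β * a α * (Q * A * frame β * 1 * frame α * (Qᴴ * B)).trace.re :=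
      sum_congr rfl fun β _ => sum_congr rfl fun α _ => by ring
    rw [this, sum_sum_mul_mul_re_trace₅ a (Q * A) 1 (Qᴴ * B), hZ, Matrix.mul_one]
  have hsplit : ∑ α, ∑ β, a α * a β *
      ((Q * frame α * 1 * frame β * (A * Qᴴ * B)).trace.re
        - (Q * frame β * A * frame α * (Qᴴ * B)).trace.re
        - (Q * frame α * A * frame β * (Qᴴ * B)).trace.re
        + (Q * A * frame β * 1 * frame α * (Qᴴ * B)).trace.re) =
      ∑ α, ∑ β, a α * a β * (Q * frame α * 1 * frame β * (A * Qᴴ * B)).trace.re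
        - ∑ α, ∑ β, a α * a β * (Q * frame β * A * frame α * (Qᴴ * B)).trace.re
        - ∑ α, ∑ β, a α * a β * (Q * frame α * A * frame β * (Qᴴ * B)).trace.re
        + ∑ α, ∑ β, a α * a β * (Q * A * frame β * 1 * frame α * (Qᴴ * B)).trace.re := by
    simp only [← sum_sub_distrib, ← sum_add_distrib]
    refine sum_congr rfl fun α _ => sum_congr rfl fun β _ => ?_
    ring
  rw [hsplit, e1, e2, e3, e4]
  ring

/-- **Single-site Hessian bound** (the analogue of Shen–Zhu–Zhu Lemma 4.1 for the quadratic potential):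
for unitary `Q, A, B` and any `Z`, each of `|Re tr(QZZAQᴴB)|`, `|Re tr(QZAZQᴴB)|`, `|Re tr(QAZZQᴴB)|` is at
most `‖Z‖_F²`. [cite: arXiv220412737, Lemma 4.1 (4.2)-(4.4)] -/
theorem abs_re_trace_quad_terms_le (hN : N ≠ 0) {Q A B : Matrix (Fin N) (Fin N) ℂ}
    (hQ : Q ∈ Matrix.unitaryGroup (Fin N) ℂ) (hA : A ∈ Matrix.unitaryGroup (Fin N) ℂ)
    (hB : B ∈ Matrix.unitaryGroup (Fin N) ℂ) (Z : Matrix (Fin N) (Fin N) ℂ) :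
    |(Q * Z * Z * (A * Qᴴ * B)).trace.re| ≤ frobNorm Z ^ 2 ∧
      |(Q * Z * A * Z * (Qᴴ * B)).trace.re| ≤ frobNorm Z ^ 2 ∧
      |(Q * A * Z * Z * (Qᴴ * B)).trace.re| ≤ frobNorm Z ^ 2 := by
  haveI : Nonempty (Fin N) := ⟨⟨0, Nat.pos_of_ne_zero hN⟩⟩
  have hQh : Qᴴ ∈ Matrix.unitaryGroup (Fin N) ℂ := Unitary.star_mem hQ
  have hQhB : Qᴴ * B ∈ Matrix.unitaryGroup (Fin N) ℂ := Submonoid.mul_mem _ hQh hB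
  have hAQhB : A * Qᴴ * B ∈ Matrix.unitaryGroup (Fin N) ℂ := Submonoid.mul_mem _ (Submonoid.mul_mem _ hA hQh) hB
  have hQA : Q * A ∈ Matrix.unitaryGroup (Fin N) ℂ := Submonoid.mul_mem _ hQ hA
  have hop1 : matrixOpNorm (A * Qᴴ * B) = 1 := matrixOpNorm_of_mem_unitaryGroup hAQhB
  have hop2 : matrixOpNorm (Qᴴ * B) = 1 := matrixOpNorm_of_mem_unitaryGroup hQhB
  have hopA : matrixOpNorm A = 1 := matrixOpNorm_of_mem_unitaryGroup hA
  have hZ0 := frobNorm_nonneg Z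
  refine ⟨?_, ?_, ?_⟩
  · -- `Re tr((QZ)(Z(AQᴴB)))`
    have h1 : (Q * Z * Z * (A * Qᴴ * B)) = (Q * Z) * (Z * (A * Qᴴ * B)) := by simp only [Matrix.mul_assoc]
    rw [h1]
    calc |((Q * Z) * (Z * (A * Qᴴ * B))).trace.re| ≤ frobNorm (Q * Z) * frobNorm (Z * (A * Qᴴ * B)) :=
          abs_re_trace_mul_le _ _
      _ ≤ frobNorm Z * (frobNorm Z * matrixOpNorm (A * Qᴴ * B)) := by
          rw [frobNorm_unitary_mul hQ]
          exact mul_le_mul_of_nonneg_left (frobNorm_mul_le_mul_matrixOpNorm _ _) hZ0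
      _ = frobNorm Z ^ 2 := by rw [hop1]; ring
  · have h1 : (Q * Z * A * Z * (Qᴴ * B)) = (Q * Z) * (A * (Z * (Qᴴ * B))) := by simp only [Matrix.mul_assoc]
    rw [h1]
    calc |((Q * Z) * (A * (Z * (Qᴴ * B)))).trace.re| ≤ frobNorm (Q * Z) * frobNorm (A * (Z * (Qᴴ * B))) :=
          abs_re_trace_mul_le _ _
      _ ≤ frobNorm Z * (matrixOpNorm A * (frobNorm Z * matrixOpNorm (Qᴴ * B))) := by
          rw [frobNorm_unitary_mul hQ]
          refine mul_le_mul_of_nonneg_left ?_ hZ0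
          exact (frobNorm_mul_le_matrixOpNorm_mul _ _).trans
            (mul_le_mul_of_nonneg_left (frobNorm_mul_le_mul_matrixOpNorm _ _) (matrixOpNorm_nonneg _))
      _ = frobNorm Z ^ 2 := by rw [hopA, hop2]; ring
  · have h1 : (Q * A * Z * Z * (Qᴴ * B)) = (Q * A * Z) * (Z * (Qᴴ * B)) := by simp only [Matrix.mul_assoc]
    rw [h1]
    calc |((Q * A * Z) * (Z * (Qᴴ * B))).trace.re| ≤ frobNorm (Q * A * Z) * frobNorm (Z * (Qᴴ * B)) :=
          abs_re_trace_mul_le _ _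
      _ ≤ frobNorm Z * (frobNorm Z * matrixOpNorm (Qᴴ * B)) := by
          rw [frobNorm_unitary_mul hQA]
          exact mul_le_mul_of_nonneg_left (frobNorm_mul_le_mul_matrixOpNorm _ _) hZ0
      _ = frobNorm Z ^ 2 := by rw [hop2]; ring

/-- **The frame Hessian of `Re tr(Q A Qᴴ B)` is bounded by `4 Γ(u,u)`** on unitary `Q`, for unitary
`A, B`: `|Σ_{αβ} D_αu D_βu D_αD_β Re tr(Q A Qᴴ B)| ≤ 4 Γ(u,u)(Q)`. [cite: arXiv220412737, Lemma 4.1 (4.2)-(4.4)] -/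
theorem abs_sum_sum_hess_quadPot_le (hN : N ≠ 0) {A B : Matrix (Fin N) (Fin N) ℂ}
    (hA : A ∈ Matrix.unitaryGroup (Fin N) ℂ) (hB : B ∈ Matrix.unitaryGroup (Fin N) ℂ)
    (u : Matrix (Fin N) (Fin N) ℂ → ℝ) {Q : Matrix (Fin N) (Fin N) ℂ} (hQ : Q ∈ Matrix.unitaryGroup (Fin N) ℂ) :
    |∑ α, ∑ β, matD (frame α) u Q * matD (frame β) u Q * matD (frame α) (matD (frame β) (quadPot A B)) Q| ≤
      4 * Gam u u Q := by
  rw [sum_sum_hess_quadPot, Gam_self_eq_frobNorm_sq hN u Q]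
  set Z := frameGrad (dirFun u Q)
  obtain ⟨h1, h2, h3⟩ := abs_re_trace_quad_terms_le hN hQ hA hB Z
  have h1' := abs_le.1 h1
  have h2' := abs_le.1 h2
  have h3' := abs_le.1 h3
  exact abs_le.2 ⟨by linarith [h1'.1, h2'.2, h3'.1], by linarith [h1'.2, h2'.1, h3'.2]⟩

/-! ### From a frame-Hessian bound to the curvature–dimension inequality -/

/-- **Curvature–dimension inequality from a Hessian bound** (Bakry–Émery on `SU(N)`, `Ric = N/2`): if the
frame Hessian form of a smooth `S` satisfies `Σ_{αβ} D_αu D_βu D_αD_βS ≤ h Γ(u,u)` at a unitary `Q` for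
the smooth `u`, then `(N/2 − h) Γ(u,u)(Q) ≤ Γ₂^S(u)(Q)`. [cite: arXiv220412737, (4.7)-(4.8) (p. 19)] -/
theorem Gam2_ge_of_hess_le (hN : N ≠ 0) {S u : Matrix (Fin N) (Fin N) ℂ → ℝ} (hS : ContDiff ℝ ∞ S)
    (hu : ContDiff ℝ ∞ u) {h : ℝ} {Q : Matrix (Fin N) (Fin N) ℂ}
    (hHess : ∑ α, ∑ β, matD (frame α) u Q * matD (frame β) u Q * matD (frame α) (matD (frame β) S) Q ≤
      h * Gam u u Q) :
    ((N : ℝ) / 2 - h) * Gam u u Q ≤ Gam2 S u Q := by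
  rw [Gam2_eq hN hS hu]
  have hRic : (N : ℝ) / 2 * Gam u u Q ≤ ∑ α, ∑ β, matD (frame α) (matD (frame β) u) Q ^ 2 := by
    have h1 := sum_sum_sq_sub_swap_le (fun α β => matD (frame α) (matD (frame β) u) Q)
    rw [sum_sum_sq_comm_matD hN hu Q] at h1
    linarith
  nlinarith [hRic, hHess, Gam_self_nonneg u Q]

/-! ### Sums of quadratic potentials: the one-link laws of single-site models -/

/-- The one-link potential of a single-site model: `S(Q) = c₀ + c Σ_{k ∈ s} Re tr(Q A_k Qᴴ B_k)`.
[cite: Makeenko2023, §14.3 (14.38)-(14.40) (PDF pp. 244-245)] -/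
def quadPotSum {ι : Type*} (s : Finset ι) (c₀ c : ℝ) (A B : ι → Matrix (Fin N) (Fin N) ℂ) :
    Matrix (Fin N) (Fin N) ℂ → ℝ :=
  fun Q => c₀ + c * ∑ k ∈ s, quadPot (A k) (B k) Q

/-- `quadPotSum` is smooth. [cite: arXiv220412737, §2 (2.4) (p. 10)] -/
theorem contDiff_quadPotSum {ι : Type*} (s : Finset ι) (c₀ c : ℝ) (A B : ι → Matrix (Fin N) (Fin N) ℂ) :
    ContDiff ℝ ∞ (quadPotSum s c₀ c A B) :=
  contDiff_const.add (contDiff_const.mul (ContDiff.sum fun k _ => contDiff_quadPot (A k) (B k)))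

section Calculus

attribute [local instance 2000] matTop

/-- Second frame derivatives of `quadPotSum` are `c` times the sum of those of the `quadPot`s. [folklore] -/
private theorem matD_matD_quadPotSum {ι : Type*} (s : Finset ι) (c₀ c : ℝ) (A B : ι → Matrix (Fin N) (Fin N) ℂ)
    (X Y Q : Matrix (Fin N) (Fin N) ℂ) :
    matD Y (matD X (quadPotSum s c₀ c A B)) Q = c * ∑ k ∈ s, matD Y (matD X (quadPot (A k) (B k))) Q := by
  have hsum : ContDiff ℝ ∞ (fun Q => ∑ k ∈ s, quadPot (A k) (B k) Q) :=
    ContDiff.sum fun k _ => contDiff_quadPot (A k) (B k)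
  have h1 : matD X (quadPotSum s c₀ c A B) = fun Q => c * ∑ k ∈ s, matD X (quadPot (A k) (B k)) Q := by
    have e : quadPotSum (N := N) s c₀ c A B = (fun _ => c₀) + fun Q => c * ∑ k ∈ s, quadPot (A k) (B k) Q := by
      funext Q; simp [quadPotSum]
    rw [e, matD_add contDiff_const (contDiff_const.mul hsum), matD_const, zero_add,
      matD_const_mul hsum, matD_sum s (fun k _ => contDiff_quadPot (A k) (B k))]
  have hsum' : ContDiff ℝ ∞ (fun Q => ∑ k ∈ s, matD X (quadPot (A k) (B k)) Q) :=
    ContDiff.sum fun k _ => contDiff_matD (contDiff_quadPot (A k) (B k)) X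
  rw [h1, matD_const_mul hsum', matD_sum s (fun k _ => contDiff_matD (contDiff_quadPot (A k) (B k)) X)]

end Calculus

/-- **Curvature of the one-link laws of single-site models**: for unitary `A_k, B_k`,
`S = c₀ + c Σ_{k∈s} Re tr(Q A_k Qᴴ B_k)` satisfies `(N/2 − 4|c|·#s) Γ(u,u)(Q) ≤ Γ₂^S(u)(Q)` at every
unitary `Q`. [cite: arXiv220412737, Lemma 4.1, (4.7)-(4.8)] -/
theorem Gam2_quadPotSum_ge (hN : N ≠ 0) {ι : Type*} (s : Finset ι) (c₀ c : ℝ)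
    {A B : ι → Matrix (Fin N) (Fin N) ℂ} (hA : ∀ k ∈ s, A k ∈ Matrix.unitaryGroup (Fin N) ℂ)
    (hB : ∀ k ∈ s, B k ∈ Matrix.unitaryGroup (Fin N) ℂ)
    {u : Matrix (Fin N) (Fin N) ℂ → ℝ} (hu : ContDiff ℝ ∞ u)
    {Q : Matrix (Fin N) (Fin N) ℂ} (hQ : Q ∈ Matrix.unitaryGroup (Fin N) ℂ) :
    ((N : ℝ) / 2 - 4 * |c| * s.card) * Gam u u Q ≤ Gam2 (quadPotSum s c₀ c A B) u Q := by
  refine Gam2_ge_of_hess_le hN (contDiff_quadPotSum s c₀ c A B) hu ?_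
  simp_rw [matD_matD_quadPotSum]
  -- swap the sums: `Σ_α Σ_β Σ_k = Σ_k Σ_α Σ_β`
  have hswap : ∑ α, ∑ β, matD (frame α) u Q * matD (frame β) u Q *
      (c * ∑ k ∈ s, matD (frame α) (matD (frame β) (quadPot (A k) (B k))) Q) =
      c * ∑ k ∈ s, ∑ α, ∑ β, matD (frame α) u Q * matD (frame β) u Q *
        matD (frame α) (matD (frame β) (quadPot (A k) (B k))) Q := by
    calc ∑ α, ∑ β, matD (frame α) u Q * matD (frame β) u Q *
          (c * ∑ k ∈ s, matD (frame α) (matD (frame β) (quadPot (A k) (B k))) Q)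
        = ∑ α, ∑ β, ∑ k ∈ s, c * (matD (frame α) u Q * matD (frame β) u Q *
            matD (frame α) (matD (frame β) (quadPot (A k) (B k))) Q) := by
          refine sum_congr rfl fun α _ => sum_congr rfl fun β _ => ?_
          rw [Finset.mul_sum, Finset.mul_sum]
          exact sum_congr rfl fun k _ => by ring
      _ = ∑ α, ∑ k ∈ s, ∑ β, c * (matD (frame α) u Q * matD (frame β) u Q *
            matD (frame α) (matD (frame β) (quadPot (A k) (B k))) Q) :=
          sum_congr rfl fun α _ => Finset.sum_comm
      _ = ∑ k ∈ s, ∑ α, ∑ β, c * (matD (frame α) u Q * matD (frame β) u Q *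
            matD (frame α) (matD (frame β) (quadPot (A k) (B k))) Q) := Finset.sum_comm
      _ = c * ∑ k ∈ s, ∑ α, ∑ β, matD (frame α) u Q * matD (frame β) u Q *
            matD (frame α) (matD (frame β) (quadPot (A k) (B k))) Q := by
          simp only [Finset.mul_sum]
  rw [hswap]
  have hk : ∀ k ∈ s, |∑ α, ∑ β, matD (frame α) u Q * matD (frame β) u Q *
      matD (frame α) (matD (frame β) (quadPot (A k) (B k))) Q| ≤ 4 * Gam u u Q :=
    fun k hk => abs_sum_sum_hess_quadPot_le hN (hA k hk) (hB k hk) u hQ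
  have hsum : |∑ k ∈ s, ∑ α, ∑ β, matD (frame α) u Q * matD (frame β) u Q *
      matD (frame α) (matD (frame β) (quadPot (A k) (B k))) Q| ≤ s.card * (4 * Gam u u Q) := by
    calc _ ≤ ∑ k ∈ s, |∑ α, ∑ β, matD (frame α) u Q * matD (frame β) u Q *
            matD (frame α) (matD (frame β) (quadPot (A k) (B k))) Q| := abs_sum_le_sum_abs _ _
      _ ≤ ∑ k ∈ s, 4 * Gam u u Q := sum_le_sum hk
      _ = s.card * (4 * Gam u u Q) := by rw [sum_const, nsmul_eq_mul]
  have hG := Gam_self_nonneg u Q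
  have h1 := (abs_le.1 hsum)
  have : c * ∑ k ∈ s, ∑ α, ∑ β, matD (frame α) u Q * matD (frame β) u Q *
      matD (frame α) (matD (frame β) (quadPot (A k) (B k))) Q ≤ |c| * (s.card * (4 * Gam u u Q)) := by
    calc _ ≤ |c * ∑ k ∈ s, ∑ α, ∑ β, matD (frame α) u Q * matD (frame β) u Q *
          matD (frame α) (matD (frame β) (quadPot (A k) (B k))) Q| := le_abs_self _
      _ = |c| * |∑ k ∈ s, ∑ α, ∑ β, matD (frame α) u Q * matD (frame β) u Q *
          matD (frame α) (matD (frame β) (quadPot (A k) (B k))) Q| := abs_mul _ _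
      _ ≤ |c| * (s.card * (4 * Gam u u Q)) := mul_le_mul_of_nonneg_left hsum (abs_nonneg c)
  linarith

/-- **Poincaré inequality for the one-link laws of single-site models** (Bakry–Émery via
`poincare_of_curvature`): for `N ≠ 0`, unitary `A_k, B_k` and `K = N/2 − 4|c|·#s > 0`, every smooth `u`
satisfies `K ∫ e^S (u − m)² dσ ≤ ∫ e^S Γ(u,u) dσ` for `S = c₀ + c Σ_{k∈s} Re tr(Q A_k Qᴴ B_k)`, `m` the
`e^S σ`-mean. [cite: BakryGentilLedoux2014, Prop. 4.8.1] -/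
theorem poincare_quadPotSum (hN : N ≠ 0) {ι : Type*} (s : Finset ι) (c₀ c : ℝ)
    {A B : ι → Matrix (Fin N) (Fin N) ℂ} (hA : ∀ k ∈ s, A k ∈ Matrix.unitaryGroup (Fin N) ℂ)
    (hB : ∀ k ∈ s, B k ∈ Matrix.unitaryGroup (Fin N) ℂ)
    (hK : 0 < (N : ℝ) / 2 - 4 * |c| * s.card)
    {u : Matrix (Fin N) (Fin N) ℂ → ℝ} (hu : ContDiff ℝ ∞ u) :
    ((N : ℝ) / 2 - 4 * |c| * s.card) *
        ∫ g : SUN N, Real.exp (quadPotSum s c₀ c A B g) * (u g -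
          (∫ g : SUN N, Real.exp (quadPotSum s c₀ c A B g) * u g ∂(haarSU N)) /
            (∫ g : SUN N, Real.exp (quadPotSum s c₀ c A B g) ∂(haarSU N))) ^ 2 ∂(haarSU N) ≤
      ∫ g : SUN N, Real.exp (quadPotSum s c₀ c A B g) * Gam u u g ∂(haarSU N) :=
  poincare_of_curvature hN (contDiff_quadPotSum s c₀ c A B) hK
    (fun _ hu g => Gam2_quadPotSum_ge hN s c₀ c hA hB hu (SUN.mem_unitaryGroup g)) hu

end SUNBakryEmery

end Literature.MathematicalPhysics.QuantumFieldTheory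

end
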